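import Literature.Probability.Percolation.ArmSeparationOutFrames
import Literature.Probability.Percolation.ArmSeparationOuterFailAt
import Literature.Probability.Percolation.ArmSeparationInnerBoundAt
import HarnessLib

/-!
# The guarded outer separation step at a general density `p`

Topic: Probability / Percolation; family `crit-perc` / near-critical percolation on `𝕋`
(`P_p = triSitePercolation p`, ANY `p : unitInterval`). `ArmSeparationExtGuard.lean` and
`ArmSeparationOutFrames.lean` prove the probabilistic side of the guarded outer separation step of
Kesten's arm separation (Nolin 2008, §4.4, proof of Thm. 11, first step, with Lemma 15
[arXiv 0711.4948: Thm. 10, Lemma 14, (4.20)]) at `p = 1/2`: the one-configuration bad event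
`outBad M T k₀ K R₀ Kg` (failure behind side `0`, or a missing corner guard at `extC₁ M`, `extC₂ M`)
is unlikely (`real_outBad_le`), hence so is `¬ OutGoodFr` (`real_not_outGoodFr_le`, the twelve
framed / colour-exchanged configurations), and the step inequality `real_armEvent_le_outStepFr`.
Nolin's theorem is uniform in `p` below `L(p)`; this file re-runs these three statements at a
general density `p` on top of the general-`p` bricks `real_setOf_outFail_le_at`
(`ArmSeparationOuterFailAt.lean`) and `real_not_inGuard_le_at` (`ArmSeparationInnerBoundAt.lean`;
the guards are CLOSED double frames, i.e. open ones of `P_{1-p}`):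

* `real_outBad_le_at` — `P_p(outBad) ≤ (1 - c₄)^{T+1} + T (1 - c_F²)^K + 2 (1 - c_F²)^{K_g}`, given
  open frames of probability `≥ c_F ∈ (0, 1]` at `p` (scales `< M`) and at `1 - p` (scales `< S`,
  `8 R₀ 32^i < S` for `i < K_g`), and `c₄ ≤ P_{1-p}(LR(4(M-1), M-1))`;
* `real_not_outGoodFr_le_at` — `P_p(¬ OutGoodFr) ≤ 12 · (…)` when these hypotheses hold at both
  `p` and `1 - p` (the frames `frameConfig i` preserve every `P_p`, `real_preimage_frameConfig`);
* `real_le_outStepFr_at` — the step inequality for ANY event split by `OutGoodFr`: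
  `E ⊆ G ∪ ({¬ OutGoodFr} ∩ A)` with `A` determined by `Λ_M` gives
  `P_p(E) ≤ P_p(G) + P_p(¬ OutGoodFr) · P_p(A)` — the arity of the arm event (two arms,
  `real_armEvent_le_outStepFr`, or four) only enters through the deterministic inclusion.

Everything here is proved; no named facts are introduced.

## References

* P. Nolin, *Near-critical percolation in two dimensions*, Electron. J. Probab. 13 (2008), Thm. 11
  and §4.4 [arXiv 0711.4948: Thm. 10 (proof, first step), Lemma 14, (4.20)]. [Nolin2008]
* H. Kesten, *Scaling relations for 2D-percolation*, Comm. Math. Phys. 109 (1987), Lemma 2. [Kesten1987]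

Tree: `outBad`, `extC₁`, `extC₂` (`ArmSeparationExtGuard.lean`); `OutGoodFr`, `not_outGoodFr_subset`,
`determinedBy_setOf_outGoodFr`, `disjoint_outGoodFrFinset_triBall` (`ArmSeparationOutFrames.lean`);
`real_setOf_outFail_le_at` (`ArmSeparationOuterFailAt.lean`); `real_not_inGuard_le_at`
(`ArmSeparationInnerBoundAt.lean`); `real_preimage_frameConfig` (`ArmSeparationInnerFrames.lean`);
`sitePercolation_real_preimage_compl`, `sitePercolation_real_inter_of_disjoint`.
-/

noncomputable section

open MeasureTheory Set
open scoped unitInterval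

namespace Literature.Probability.Percolation

open LatticeModels

/-- **`P_p(outBad) ≤ (1 - c₄)^{T+1} + T (1 - c_F²)^K + 2 (1 - c_F²)^{K_g}`** at a general density `p`
(`M ≥ 3`, `k₀, R₀ ≥ 1`, `16 k_j + 1 ≤ M` for `j < K`, `8 R₀ 32^i < S` for `i < K_g`): failure behind
side `0` is bounded by `real_setOf_outFail_le_at` (open frames at `p`, blocking crossing at
`1 - p`), each missing guard by `real_not_inGuard_le_at` (open frames at `1 - p`). [cite: Nolin2008, §4.4 Lemma 15 (proof) (arXiv 0711.4948: Lemma 14, (4.20)), with Thm. 11 "uniformly in p"] -/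
theorem real_outBad_le_at (p : unitInterval) {cF c₄ : ℝ} (hcF : 0 < cF) (hcF1 : cF ≤ 1) {M S : ℕ}
    (hF : ∀ (z : Site 2) (k : ℕ), 1 ≤ k → k < M → cF ≤ (triSitePercolation p).real (triFrameAt z k))
    (hFσ : ∀ (z : Site 2) (k : ℕ), 1 ≤ k → k < S → cF ≤ (triSitePercolation (σ p)).real (triFrameAt z k))
    (hM : 3 ≤ M) (hc₄ : c₄ ≤ triLRCrossingProb (σ p) (4 * (M - 1)) (M - 1))
    {T k₀ K R₀ Kg : ℕ} (hk₀ : 1 ≤ k₀) (hR₀ : 1 ≤ R₀) (hKM : ∀ j < K, 16 * (trapScale k₀ j : ℤ) + 1 ≤ M)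
    (hKgS : ∀ i < Kg, 8 * trapScale R₀ i < S) :
    (triSitePercolation p).real (outBad M T k₀ K R₀ Kg) ≤
      (1 - c₄) ^ (T + 1) + T * (1 - cF ^ 2) ^ K + 2 * (1 - cF ^ 2) ^ Kg := by
  have h1 := real_setOf_outFail_le_at p hcF hcF1 hF hM hc₄ (T := T) hk₀ hKM
  have h2 := real_not_inGuard_le_at p hcF hFσ hR₀ hKgS (extC₁ M)
  have h3 := real_not_inGuard_le_at p hcF hFσ hR₀ hKgS (extC₂ M)
  have hset : outBad M T k₀ K R₀ Kg = {χ | OutFail M T k₀ K χ} ∪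
      ({χ | ¬ InGuard R₀ Kg (extC₁ M) χ} ∪ {χ | ¬ InGuard R₀ Kg (extC₂ M) χ}) := by
    ext χ; simp only [outBad, Set.mem_setOf_eq, Set.mem_union]
  rw [hset]
  refine (measureReal_union_le _ _).trans ?_
  refine (add_le_add le_rfl (measureReal_union_le _ _)).trans ?_
  linarith

/-- **Nothing fails around `∂Λ_{2M}` (framed, guarded) except with small probability, at a general
density `p`**: `P_p(¬ OutGoodFr M T k₀ K R₀ K_g) ≤ 12 · ((1 - c₄)^{T+1} + T (1 - c_F²)^K + 2 (1 - c_F²)^{K_g})`,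
given at both densities `q ∈ {p, 1 - p}` open frames of probability `≥ c_F ∈ (0, 1]` at the scales
`< M` and `< S`, and the RSW bound `c₄ ≤ P_q(LR(4(M-1), M-1))` — six framed copies of `outBad` at
`p` (`real_preimage_frameConfig`, every `p`) and six colour-exchanged ones, of law `P_{1-p}`. [cite: Nolin2008, §4.4 Lemma 15 and Thm. 11 (proof) (arXiv 0711.4948: Lemma 14 (4.20), Thm. 10), with Thm. 11 "uniformly in p"] -/
theorem real_not_outGoodFr_le_at (p : unitInterval) {cF c₄ : ℝ} (hcF : 0 < cF) (hcF1 : cF ≤ 1) {M S : ℕ}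
    (hF : ∀ q : unitInterval, (q = p ∨ q = σ p) →
      ∀ (z : Site 2) (k : ℕ), 1 ≤ k → k < M → cF ≤ (triSitePercolation q).real (triFrameAt z k))
    (hFS : ∀ q : unitInterval, (q = p ∨ q = σ p) →
      ∀ (z : Site 2) (k : ℕ), 1 ≤ k → k < S → cF ≤ (triSitePercolation q).real (triFrameAt z k))
    (hM : 3 ≤ M)
    (hc₄ : ∀ q : unitInterval, (q = p ∨ q = σ p) → c₄ ≤ triLRCrossingProb q (4 * (M - 1)) (M - 1))
    {T k₀ K R₀ Kg : ℕ} (hk₀ : 1 ≤ k₀) (hR₀ : 1 ≤ R₀) (hKM : ∀ j < K, 16 * (trapScale k₀ j : ℤ) + 1 ≤ M)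
    (hKgS : ∀ i < Kg, 8 * trapScale R₀ i < S) :
    (triSitePercolation p).real {ω | ¬ OutGoodFr M T k₀ K R₀ Kg ω} ≤
      12 * ((1 - c₄) ^ (T + 1) + T * (1 - cF ^ 2) ^ K + 2 * (1 - cF ^ 2) ^ Kg) := by
  set B := outBad M T k₀ K R₀ Kg with hB
  set ε := (1 - c₄) ^ (T + 1) + T * (1 - cF ^ 2) ^ K + 2 * (1 - cF ^ 2) ^ Kg with hε
  have hσσ : σ (σ p) = p := unitInterval.symm_symm p
  have hbad : (triSitePercolation p).real B ≤ ε :=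
    real_outBad_le_at p hcF hcF1 (hF p (Or.inl rfl)) (hFS (σ p) (Or.inr rfl)) hM (hc₄ (σ p) (Or.inr rfl))
      hk₀ hR₀ hKM hKgS
  have hbad' : (triSitePercolation (σ p)).real B ≤ ε := by
    refine real_outBad_le_at (σ p) hcF hcF1 (hF (σ p) (Or.inr rfl)) ?_ hM ?_ hk₀ hR₀ hKM hKgS
    · rw [hσσ]; exact hFS p (Or.inl rfl)
    · have hc : c₄ ≤ triLRCrossingProb (σ (σ p)) (4 * (M - 1)) (M - 1) := by rw [hσσ]; exact hc₄ p (Or.inl rfl)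
      exact hc
  have hrot : ∀ i : ℕ, (triSitePercolation p).real (frameConfig i ⁻¹' B) ≤ ε := fun i => by
    rw [real_preimage_frameConfig]; exact hbad
  have hrotc : ∀ i : ℕ, (triSitePercolation p).real (frameConfig i ⁻¹' (compl ⁻¹' B)) ≤ ε := fun i => by
    rw [real_preimage_frameConfig]
    unfold triSitePercolation
    rw [sitePercolation_real_preimage_compl]
    exact hbad'
  calc (triSitePercolation p).real {ω | ¬ OutGoodFr M T k₀ K R₀ Kg ω}
      ≤ (triSitePercolation p).real
          (⋃ i ∈ Finset.range 6, (frameConfig i ⁻¹' B ∪ frameConfig i ⁻¹' (compl ⁻¹' B))) :=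
        measureReal_mono (not_outGoodFr_subset M T k₀ K R₀ Kg) (measure_ne_top _ _)
    _ ≤ ∑ i ∈ Finset.range 6, (triSitePercolation p).real (frameConfig i ⁻¹' B ∪ frameConfig i ⁻¹' (compl ⁻¹' B)) :=
        measureReal_biUnion_finset_le _ _
    _ ≤ ∑ i ∈ Finset.range 6, (ε + ε) := Finset.sum_le_sum fun i _ =>
        (measureReal_union_le _ _).trans (add_le_add (hrot i) (hrotc i))
    _ = 12 * ε := by rw [Finset.sum_const, Finset.card_range, nsmul_eq_mul]; push_cast; ring

/-- **The guarded outer separation step for ANY event split by `OutGoodFr`, at density `p`**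
(Nolin 2008, §4.4, p. 12: `P(A(2^k,2^K)) ≤ P(Ã(2^k,2^K)) + 4δ · P(A(2^k,2^{K-1}))`, "by
independence"): if `E ⊆ G ∪ ({¬ OutGoodFr M T k₀ K R₀ K_g} ∩ A)` with `A` determined by the sites
of `Λ_M`, then `P_p(E) ≤ P_p(G) + P_p(¬ OutGoodFr) · P_p(A)` (`1 ≤ M`, `2 k_j + 1 ≤ R < M`,
`16 R₀ 32^i ≤ R_g < M`; `OutGoodFr` is determined by `{M < |v| ≤ 4M}`). [cite: Nolin2008, §4.4 (arXiv 0711.4948: proof of Thm. 10, p. 12); Kesten1987, Lemma 2] -/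
theorem real_le_outStepFr_at (p : unitInterval) {M T k₀ K R₀ Kg R Rg : ℕ} (hM : 1 ≤ M)
    (hR : ∀ j < K, 2 * trapScale k₀ j + 1 ≤ R) (hRM : R < M) (hRg : ∀ i < Kg, 16 * trapScale R₀ i ≤ Rg) (hRgM : Rg < M)
    {E G A : Set (SiteConfig (Site 2))} (hA : DeterminedBy A ↑(triBall M))
    (hsub : E ⊆ G ∪ ({ω | ¬ OutGoodFr M T k₀ K R₀ Kg ω} ∩ A)) :
    (triSitePercolation p).real E ≤
      (triSitePercolation p).real G +
        (triSitePercolation p).real {ω | ¬ OutGoodFr M T k₀ K R₀ Kg ω} * (triSitePercolation p).real A := by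
  have dG : DeterminedBy {ω : SiteConfig (Site 2) | ¬ OutGoodFr M T k₀ K R₀ Kg ω} ↑(outGoodFrFinset M) :=
    (determinedBy_setOf_outGoodFr hM hR hRM hRg hRgM).compl
  have hind := sitePercolation_real_inter_of_disjoint p dG hA (disjoint_outGoodFrFinset_triBall M)
  unfold triSitePercolation at hind ⊢
  calc (sitePercolation (Site 2) p).real E
      ≤ (sitePercolation (Site 2) p).real (G ∪ ({ω | ¬ OutGoodFr M T k₀ K R₀ Kg ω} ∩ A)) :=
        measureReal_mono hsub (measure_ne_top _ _)
    _ ≤ (sitePercolation (Site 2) p).real G +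
          (sitePercolation (Site 2) p).real ({ω | ¬ OutGoodFr M T k₀ K R₀ Kg ω} ∩ A) :=
        measureReal_union_le _ _
    _ = _ := by rw [hind]

end Literature.Probability.Percolation
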